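import Mathlib
import Literature.Probability.Percolation.PercolationProofs
import Literature.Probability.LatticeModels.ProdBernoulliIndependence
import Literature.Probability.Percolation.KozmaNitzanPinning
import HarnessLib

/-!
# `NoHeavyLowerTail` (stmt-CriticalPhenomena-4575), line fat-minority-linear — the ORDERED-ANCHOR theorem
Route task `nh-dp-fatminority` (gen 5); Kozma–Nitzan's Question 9 at depth 2 for a GLUED BLOCK.
Observer `o` glued by weight-`1` pairs to units `X` (its only positive pairs), units attached only to
relays `A` (and `o`), `b, a ∈ A`, `rk` an injective rank on `A`; `T_c = {s(x,c') : x ∈ X, rk c' < rk c}`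
(attachments into earlier relays), `Att_c = {∃ x ∈ X, s(x,c) open}`, `μ_c = prodBernoulli (pinW w T_c ∅)`.
* `orderedAnchor_of_pieces`: the piece inequalities `μ_c({a↔b} ∩ Att_c) ≤ μ_c({o↔b} ∩ Att_c)`
  (`c ∉ {a,b}`) give `μ(o ↔ A, o ↮ b) ≤ μ(o ↔ A, a ↮ b)` (pre-FKG inequality with anchor `a`, i.e. linear
  gluing with constant `1`): `{o ↔ A}` is a.s. the disjoint union of the pieces "first attached relay
  is `c`", conditioning on the closed pairs is pinning, and the pieces `c = b`, `c = a` are free.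
* `orderedAnchor_glued`: the piece inequality follows from the glued comparisons
  `μ_{c,x}(a ↔ b) ≤ μ_{c,x}(o ↔ b)` (`x ∈ X`, `w s(x,c) ≠ 0`; `μ_{c,x}` = `μ_c` with `s(x,c)` pinned open
  and `s(x',c)`, `x' < x`, closed — first attached unit), the EXACT piece criterion of
  `FINDINGS-fat-minority-gen5.md` §7; the unglued ordering hypothesis `OL` implies it (piece lemma).
Numerically some rank satisfies the glued comparisons with `a = argmin_{G∖o} μ(·↔b)` in every instance
(327/327).  No new definitions.
-/



namespace Summit.CriticalPhenomena.PercolationContinuityZ3.Theorems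

open MeasureTheory Set
open Literature.Probability.LatticeModels (prodBernoulli)
open Literature.Probability.Percolation (BondConfig openConn openGraph openGraph_adj)
open scoped BigOperators

noncomputable section
open Classical
open Literature.Probability.LatticeModels Literature.Probability.Percolation

variable {n : ℕ}

/-- The pieces "relay `c` is attached to the block and no relay of smaller rank is" are pairwise
disjoint over `c ∈ A` (ranks injective on `A`). [folklore] -/
theorem orderedAnchor_pieces_disjoint (X A : Finset (Fin n)) (rk : Fin n → ℕ) (hrk : Set.InjOn rk ↑A)
    {c c' : Fin n} (hc : c ∈ A) (hc' : c' ∈ A) (hne : c ≠ c') :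
    Disjoint
      ({ω : BondConfig (Fin n) | ∃ x ∈ X, s(x, c) ∈ ω} ∩
        localCylinder (↑((X ×ˢ A.filter fun d => rk d < rk c).image fun p => s(p.1, p.2)) : Set (Sym2 (Fin n))) ∅)
      ({ω : BondConfig (Fin n) | ∃ x ∈ X, s(x, c') ∈ ω} ∩
        localCylinder (↑((X ×ˢ A.filter fun d => rk d < rk c').image fun p => s(p.1, p.2)) : Set (Sym2 (Fin n))) ∅) := by
  rw [Set.disjoint_left]
  rintro ω ⟨⟨x, hx, hxc⟩, hcl⟩ ⟨⟨x', hx', hxc'⟩, hcl'⟩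
  have hrne : rk c ≠ rk c' := fun h => hne (hrk (Finset.mem_coe.2 hc) (Finset.mem_coe.2 hc') h)
  rcases lt_or_gt_of_ne hrne with hlt | hgt
  · -- `c` earlier than `c'`: `s(x,c)` is a pair of `T_{c'}`, closed on the second piece
    have hmem : s(x, c) ∈ (↑((X ×ˢ A.filter fun d => rk d < rk c').image fun p => s(p.1, p.2)) :
        Set (Sym2 (Fin n))) :=
      Finset.mem_coe.2 (Finset.mem_image.2 ⟨(x, c), Finset.mem_product.2 ⟨hx, Finset.mem_filter.2 ⟨hc, hlt⟩⟩, rfl⟩)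
    exact (Set.notMem_empty _) ((hcl' _ hmem).1 hxc)
  · have hmem : s(x', c') ∈ (↑((X ×ˢ A.filter fun d => rk d < rk c).image fun p => s(p.1, p.2)) :
        Set (Sym2 (Fin n))) :=
      Finset.mem_coe.2 (Finset.mem_image.2 ⟨(x', c'), Finset.mem_product.2 ⟨hx', Finset.mem_filter.2 ⟨hc', hgt⟩⟩, rfl⟩)
    exact (Set.notMem_empty _) ((hcl _ hmem).1 hxc')

/-- The attached event `⋃_{c ∈ A} {c attached}` is the union of the pieces (take the attached relay of
least rank). [folklore] -/
theorem orderedAnchor_pieces_cover (X A : Finset (Fin n)) (rk : Fin n → ℕ) :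
    (⋃ c ∈ A, {ω : BondConfig (Fin n) | ∃ x ∈ X, s(x, c) ∈ ω}) =
      ⋃ c ∈ A, ({ω : BondConfig (Fin n) | ∃ x ∈ X, s(x, c) ∈ ω} ∩
        localCylinder (↑((X ×ˢ A.filter fun d => rk d < rk c).image fun p => s(p.1, p.2)) : Set (Sym2 (Fin n))) ∅) := by
  ext ω
  constructor
  · intro h
    -- the attached relays
    set Att : Finset (Fin n) := A.filter fun c => ∃ x ∈ X, s(x, c) ∈ ω with hAtt
    have hne : Att.Nonempty := by
      obtain ⟨c, hc, hxc⟩ := Set.mem_iUnion₂.1 h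
      exact ⟨c, Finset.mem_filter.2 ⟨hc, hxc⟩⟩
    obtain ⟨c, hcAtt, hmin⟩ := Finset.exists_min_image Att rk hne
    obtain ⟨hcA, hxc⟩ := Finset.mem_filter.1 hcAtt
    refine Set.mem_iUnion₂.2 ⟨c, hcA, hxc, ?_⟩
    intro e he
    obtain ⟨p, hp, rfl⟩ := Finset.mem_image.1 (Finset.mem_coe.1 he)
    obtain ⟨hp1, hp2⟩ := Finset.mem_product.1 hp
    obtain ⟨hp2A, hlt⟩ := Finset.mem_filter.1 hp2
    refine ⟨fun hopen => ?_, fun hem => absurd hem (Set.notMem_empty _)⟩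
    have : rk c ≤ rk p.2 := hmin p.2 (Finset.mem_filter.2 ⟨hp2A, p.1, hp1, hopen⟩)
    exact absurd hlt (not_lt.2 this)
  · intro h
    obtain ⟨c, hc, hω⟩ := Set.mem_iUnion₂.1 h
    exact Set.mem_iUnion₂.2 ⟨c, hc, hω.1⟩

/-- **Ordered-anchor theorem for a glued block, from per-piece inequalities (pre-FKG form).**
`o ∉ A ∪ X`, `X ∩ A = ∅`, `b, a ∈ A`; `o`'s pairs to `X` have weight `1` and `o` has no other positive
pair; units are attached only to `A ∪ {o}`; `rk` injective on `A`.  If for every `c ∈ A ∖ {a, b}`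
`μ_c({a ↔ b} ∩ Att_c) ≤ μ_c({o ↔ b} ∩ Att_c)` with `μ_c = prodBernoulli (pinW w T_c ∅)`,
`T_c = {s(x,c') : x ∈ X, c' ∈ A, rk c' < rk c}`, `Att_c = {∃ x ∈ X, s(x,c) open}`, then
`μ(o ↔ A, o ↮ b) ≤ μ(o ↔ A, a ↮ b)`.
[cite: KozmaNitzan2024, §3.2 Theorems 4–5 (p. 13) and Question 9 (p. 36)] -/
theorem orderedAnchor_of_pieces (w : Sym2 (Fin n) → unitInterval) (X A : Finset (Fin n)) (o a b : Fin n)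
    (rk : Fin n → ℕ) (hrk : Set.InjOn rk ↑A)
    (hoX : o ∉ X) (hoA : o ∉ A) (hXA : Disjoint X A) (hb : b ∈ A) (ha : a ∈ A)
    (hstar : ∀ x ∈ X, w s(o, x) = 1)
    (hstar0 : ∀ y : Fin n, y ≠ o → y ∉ X → w s(o, y) = 0)
    (hunit : ∀ x ∈ X, ∀ z : Fin n, z ≠ o → z ∉ A → w s(x, z) = 0)
    (hPiece : ∀ c ∈ A, c ≠ a → c ≠ b →
      (prodBernoulli (pinW w
          (↑((X ×ˢ A.filter fun d => rk d < rk c).image fun p => s(p.1, p.2)) : Set (Sym2 (Fin n))) ∅)).real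
        (openConn a b ∩ {ω : BondConfig (Fin n) | ∃ x ∈ X, s(x, c) ∈ ω}) ≤
      (prodBernoulli (pinW w
          (↑((X ×ˢ A.filter fun d => rk d < rk c).image fun p => s(p.1, p.2)) : Set (Sym2 (Fin n))) ∅)).real
        (openConn o b ∩ {ω : BondConfig (Fin n) | ∃ x ∈ X, s(x, c) ∈ ω})) :
    (prodBernoulli w).real ((⋃ c ∈ A, openConn o c) ∩ (openConn o b)ᶜ) ≤
      (prodBernoulli w).real ((⋃ c ∈ A, openConn o c) ∩ (openConn a b)ᶜ) := by
  set μ := prodBernoulli w with hμ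
  set S : Finset (Sym2 (Fin n)) := X.image fun x => s(o, x) with hSdef
  set Att : Fin n → Set (BondConfig (Fin n)) := fun c => {ω | ∃ x ∈ X, s(x, c) ∈ ω} with hAtt
  set T : Fin n → Finset (Sym2 (Fin n)) := fun c => (X ×ˢ A.filter fun d => rk d < rk c).image fun p => s(p.1, p.2)
    with hT
  set Piece : Fin n → Set (BondConfig (Fin n)) := fun c => Att c ∩ localCylinder (↑(T c) : Set (Sym2 (Fin n))) ∅
    with hPieceDef
  set U : Set (BondConfig (Fin n)) := ⋃ c ∈ A, Att c with hU
  have hmeas : ∀ E : Set (BondConfig (Fin n)), MeasurableSet E := fun _ => MeasurableSet.of_discrete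
  -- null events: a star pair closed, or a weight-zero pair open
  set Z : Finset (Sym2 (Fin n)) := Finset.univ.filter fun e : Sym2 (Fin n) => w e = 0 with hZ
  set Null : Set (BondConfig (Fin n)) :=
    {ω | ¬ (↑S : Set (Sym2 (Fin n))) ⊆ ω} ∪ ⋃ e ∈ Z, {ω : BondConfig (Fin n) | e ∈ ω} with hNull
  have hNull0 : μ.real Null = 0 := by
    have h1 : μ.real {ω : BondConfig (Fin n) | ¬ (↑S : Set (Sym2 (Fin n))) ⊆ ω} = 0 := by
      have hsub : {ω : BondConfig (Fin n) | ¬ (↑S : Set (Sym2 (Fin n))) ⊆ ω} ⊆ ⋃ e ∈ S, {ω | e ∉ ω} := by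
        intro ω hω
        simp only [Set.mem_setOf_eq, Set.not_subset] at hω
        obtain ⟨e, he, heω⟩ := hω
        exact Set.mem_iUnion₂.2 ⟨e, Finset.mem_coe.1 he, heω⟩
      refine le_antisymm ((measureReal_mono hsub (measure_ne_top _ _)).trans
        ((measureReal_biUnion_finset_le S _).trans (le_of_eq ?_))) measureReal_nonneg
      refine Finset.sum_eq_zero fun e he => ?_
      obtain ⟨x, hx, rfl⟩ := Finset.mem_image.1 he
      rw [hμ, prodBernoulli_real_setOf_notMem, hstar x hx]
      simp
    have h2 : μ.real (⋃ e ∈ Z, {ω : BondConfig (Fin n) | e ∈ ω}) = 0 := by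
      refine le_antisymm ((measureReal_biUnion_finset_le Z _).trans (le_of_eq ?_)) measureReal_nonneg
      refine Finset.sum_eq_zero fun e he => ?_
      have he0 : w e = 0 := (Finset.mem_filter.1 he).2
      have hset : {ω : BondConfig (Fin n) | e ∈ ω} = {ω | (↑({e} : Finset (Sym2 (Fin n))) : Set _) ⊆ ω} := by
        ext ω; simp
      rw [hset, hμ, prodBernoulli_real_subset, Finset.prod_singleton, he0]
      rfl
    refine le_antisymm ?_ measureReal_nonneg
    calc μ.real Null ≤ μ.real {ω : BondConfig (Fin n) | ¬ (↑S : Set (Sym2 (Fin n))) ⊆ ω} +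
          μ.real (⋃ e ∈ Z, {ω : BondConfig (Fin n) | e ∈ ω}) := measureReal_union_le _ _
      _ = 0 := by rw [h1, h2, add_zero]
  -- `{o ↔ A} ⊆ U ∪ Null` and `U ⊆ {o ↔ A} ∪ Null`
  have hAU : (⋃ c ∈ A, openConn o c) ⊆ U ∪ Null := by
    intro ω hω
    by_cases hN : ω ∈ Null
    · exact Or.inr hN
    left
    have hZ' : ∀ e : Sym2 (Fin n), w e = 0 → e ∉ ω := by
      intro e he0 heω
      exact hN (Or.inr (Set.mem_iUnion₂.2 ⟨e, by simp [hZ, he0], heω⟩))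
    obtain ⟨c, hc, hoc⟩ := Set.mem_iUnion₂.1 hω
    -- walk along an open path from `o`: the first step is to a unit, the second to a relay
    obtain ⟨p⟩ := (hoc : (openGraph ω).Reachable o c)
    have hco : c ≠ o := fun h => hoA (h ▸ hc)
    -- the set `C = {o} ∪ X` is left by any walk to `c ∉ C`; the exit edge gives an attachment
    have key : ∀ (u v : Fin n) (q : (openGraph ω).Walk u v), (u = o ∨ u ∈ X) → v ∈ A → ω ∈ U := by
      intro u v q
      induction q with
      | nil =>
          intro hu hv
          rcases hu with rfl | hu
          · exact absurd hv hoA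
          · exact absurd (Finset.mem_inter.2 ⟨hu, hv⟩) (by rw [Finset.disjoint_iff_inter_eq_empty.1 hXA]; simp)
      | cons hadj q' ih =>
          intro hu hv
          rename_i u' v' w'
          rw [openGraph_adj] at hadj
          obtain ⟨he, hne⟩ := hadj
          rcases hu with rfl | hu
          · -- first step from `o`: must be a unit
            by_cases hvX : v' ∈ X
            · exact ih (Or.inr hvX) hv
            · exact absurd he (hZ' _ (hstar0 v' (Ne.symm hne) hvX))
          · -- step from a unit `u'`: to `o`, or to a relay (attachment), else a null pair
            by_cases hvo : v' = o
            · exact ih (Or.inl hvo) hv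
            · by_cases hvA : v' ∈ A
              · exact Set.mem_iUnion₂.2 ⟨v', hvA, u', hu, he⟩
              · exact absurd he (hZ' _ (hunit u' hu v' hvo hvA))
    exact key o c p (Or.inl rfl) hc
  -- absorbing the null set
  have hleN : ∀ E E' : Set (BondConfig (Fin n)), E ⊆ E' ∪ Null → μ.real E ≤ μ.real E' := by
    intro E E' h
    calc μ.real E ≤ μ.real (E' ∪ Null) := measureReal_mono h (measure_ne_top _ _)
      _ ≤ μ.real E' + μ.real Null := measureReal_union_le _ _
      _ = μ.real E' := by rw [hNull0, add_zero]
  -- off `Null`, an attached relay is joined to `o` through the (open) star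
  have hreach : ∀ ω : BondConfig (Fin n), ω ∉ Null → ∀ c ∈ A, ω ∈ Att c →
      (openGraph ω).Reachable o c := by
    intro ω hN c hc hω
    have hS : (↑S : Set (Sym2 (Fin n))) ⊆ ω := by by_contra h; exact hN (Or.inl h)
    obtain ⟨x, hx, hxc⟩ := hω
    have hox : (openGraph ω).Adj o x := (openGraph_adj ω o x).2
      ⟨hS (Finset.mem_coe.2 (Finset.mem_image.2 ⟨x, hx, rfl⟩)), fun h => hoX (h ▸ hx)⟩
    have hxc' : (openGraph ω).Adj x c := (openGraph_adj ω x c).2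
      ⟨hxc, fun h => Finset.disjoint_left.1 hXA hx (h ▸ hc)⟩
    exact hox.reachable.trans hxc'.reachable
  have hUA : U ⊆ (⋃ c ∈ A, openConn o c) ∪ Null := by
    intro ω hω
    by_cases hN : ω ∈ Null
    · exact Or.inr hN
    obtain ⟨c, hc, hωc⟩ := Set.mem_iUnion₂.1 hω
    exact Or.inl (Set.mem_iUnion₂.2 ⟨c, hc, hreach ω hN c hc hωc⟩)
  -- hence `μ(E ∩ {o ↔ A}) = μ(E ∩ U)` for every event `E`
  have hAeqU : ∀ E : Set (BondConfig (Fin n)),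
      μ.real ((⋃ c ∈ A, openConn o c) ∩ E) = μ.real (U ∩ E) := fun E =>
    le_antisymm (hleN _ _ fun ω ⟨h1, h2⟩ => (hAU h1).elim (fun h => Or.inl ⟨h, h2⟩) Or.inr)
      (hleN _ _ fun ω ⟨h1, h2⟩ => (hUA h1).elim (fun h => Or.inl ⟨h, h2⟩) Or.inr)
  -- `U` is the disjoint union of the pieces
  have hUcover : U = ⋃ c ∈ A, Piece c := orderedAnchor_pieces_cover X A rk
  have hdisj : (↑A : Set (Fin n)).PairwiseDisjoint Piece := by
    intro c hc c' hc' hne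
    exact orderedAnchor_pieces_disjoint X A rk hrk (Finset.mem_coe.1 hc) (Finset.mem_coe.1 hc') hne
  have hsum : ∀ E : Set (BondConfig (Fin n)), μ.real (U ∩ E) = ∑ c ∈ A, μ.real (E ∩ Piece c) := by
    intro E
    have : U ∩ E = ⋃ c ∈ A, (E ∩ Piece c) := by
      rw [hUcover]; ext ω; simp only [Set.mem_inter_iff, Set.mem_iUnion]; tauto
    rw [this]
    exact measureReal_biUnion_finset (fun c hc c' hc' hne =>
      (hdisj hc hc' hne).mono Set.inter_subset_right Set.inter_subset_right) (fun c _ => hmeas _)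
  -- per piece: `μ({a↔b} ∩ Piece c) ≤ μ({o↔b} ∩ Piece c)`
  have hpiece : ∀ c ∈ A, μ.real (openConn a b ∩ Piece c) ≤ μ.real (openConn o b ∩ Piece c) := by
    intro c hc
    by_cases hcb : c = b
    · -- free piece: on `Att b` (star open) `o ↔ b`
      subst hcb
      refine (measureReal_mono Set.inter_subset_right (measure_ne_top _ _)).trans
        (hleN _ _ fun ω hω => ?_)
      by_cases hN : ω ∈ Null
      · exact Or.inr hN
      · exact Or.inl ⟨hreach ω hN c hc hω.1, hω⟩
    by_cases hca : c = a
    · -- free piece: on `Att a` (star open) `a ↔ o`, so `{a ↔ b} ⊆ {o ↔ b}`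
      subst hca
      refine hleN _ _ fun ω hω => ?_
      by_cases hN : ω ∈ Null
      · exact Or.inr hN
      · exact Or.inl ⟨(hreach ω hN c hc hω.2.1).trans hω.1, hω.2⟩
    -- conditioning on the earlier attachments closed is pinning
    -- the piece lemma, after pinning the earlier attachments closed
    have hpin : ∀ E : Set (BondConfig (Fin n)), μ.real (E ∩ Piece c) =
        μ.real (localCylinder (↑(T c) : Set (Sym2 (Fin n))) ∅) *
          (prodBernoulli (pinW w (↑(T c) : Set (Sym2 (Fin n))) ∅)).real (E ∩ Att c) := by
      intro E
      have : E ∩ Piece c = (E ∩ Att c) ∩ localCylinder (↑(T c) : Set (Sym2 (Fin n))) ∅ := by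
        rw [hPieceDef]; ext ω; simp only [Set.mem_inter_iff]; tauto
      rw [this, hμ, prodBernoulli_real_inter_localCylinder w (T c) ∅ (hmeas _)]
    rw [hpin, hpin]
    exact mul_le_mul_of_nonneg_left (hPiece c hc hca hcb) measureReal_nonneg
  -- assemble: `μ(o↔A ∩ o↔b) ≥ μ(o↔A ∩ a↔b)`
  have hkey : μ.real ((⋃ c ∈ A, openConn o c) ∩ openConn a b) ≤
      μ.real ((⋃ c ∈ A, openConn o c) ∩ openConn o b) := by
    rw [hAeqU, hAeqU, hsum, hsum]
    exact Finset.sum_le_sum hpiece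
  have h1 := measureReal_inter_add_sdiff (μ := μ) (s := ⋃ c ∈ A, openConn o c) (t := openConn a b) (hmeas _)
    (measure_ne_top _ _)
  have h2 := measureReal_inter_add_sdiff (μ := μ) (s := ⋃ c ∈ A, openConn o c) (t := openConn o b) (hmeas _)
    (measure_ne_top _ _)
  rw [Set.sdiff_eq] at h1 h2
  linarith

/-- Decomposition of "`c` is attached to the block `X`" by the FIRST attached unit (in the order of
`Fin n`): the cylinders "`s(x,c)` open, `s(x',c)` closed for `x' < x`" cover the event. [folklore] -/
theorem orderedAnchor_units_cover (X : Finset (Fin n)) (c : Fin n) :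
    {ω : BondConfig (Fin n) | ∃ x ∈ X, s(x, c) ∈ ω} =
      ⋃ x ∈ X, localCylinder
        (↑(insert s(x, c) ((X.filter fun x' => x' < x).image fun x' => s(x', c))) : Set (Sym2 (Fin n)))
        {s(x, c)} := by
  ext ω
  simp only [Set.mem_setOf_eq, Set.mem_iUnion]
  constructor
  · rintro ⟨x, hx, hxc⟩
    set Att : Finset (Fin n) := X.filter fun y => s(y, c) ∈ ω with hAtt
    have hne : Att.Nonempty := ⟨x, Finset.mem_filter.2 ⟨hx, hxc⟩⟩
    obtain ⟨x₀, hx₀Att, hmin⟩ := Finset.exists_min_image Att (fun y => y) hne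
    obtain ⟨hx₀X, hx₀c⟩ := Finset.mem_filter.1 hx₀Att
    refine ⟨x₀, hx₀X, fun e he => ?_⟩
    rcases Finset.mem_insert.1 (Finset.mem_coe.1 he) with rfl | he'
    · exact ⟨fun _ => Set.mem_singleton _, fun _ => hx₀c⟩
    · obtain ⟨x', hx', rfl⟩ := Finset.mem_image.1 he'
      obtain ⟨hx'X, hlt⟩ := Finset.mem_filter.1 hx'
      refine ⟨fun hopen => ?_, fun hmem => ?_⟩
      · exact absurd hlt (not_lt.2 (hmin x' (Finset.mem_filter.2 ⟨hx'X, hopen⟩)))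
      · have hEq : s(x', c) = s(x₀, c) := Set.mem_singleton_iff.1 hmem
        rcases Sym2.eq_iff.1 hEq with ⟨h1, _⟩ | ⟨h1, h2⟩
        · exact absurd (h1 ▸ hlt) (lt_irrefl _)
        · exact absurd ((h1.trans h2) ▸ hlt) (lt_irrefl _)
  · rintro ⟨x, hx, hcyl⟩
    exact ⟨x, hx, (hcyl _ (Finset.mem_coe.2 (Finset.mem_insert_self _ _))).2 (Set.mem_singleton _)⟩

/-- The first-attached-unit cylinders of distinct units are disjoint. [folklore] -/
theorem orderedAnchor_units_disjoint (X : Finset (Fin n)) (c : Fin n) {x x' : Fin n}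
    (hx : x ∈ X) (hx' : x' ∈ X) (hne : x ≠ x') :
    Disjoint
      (localCylinder
        (↑(insert s(x, c) ((X.filter fun y => y < x).image fun y => s(y, c))) : Set (Sym2 (Fin n))) {s(x, c)})
      (localCylinder
        (↑(insert s(x', c) ((X.filter fun y => y < x').image fun y => s(y, c))) : Set (Sym2 (Fin n)))
        {s(x', c)}) := by
  rw [Set.disjoint_left]
  intro ω h h'
  have hxc : s(x, c) ∈ ω :=
    (h _ (Finset.mem_coe.2 (Finset.mem_insert_self _ _))).2 (Set.mem_singleton _)
  have hx'c : s(x', c) ∈ ω :=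
    (h' _ (Finset.mem_coe.2 (Finset.mem_insert_self _ _))).2 (Set.mem_singleton _)
  rcases lt_or_gt_of_ne hne with hlt | hgt
  · have hmem : s(x, c) ∈ (↑(insert s(x', c) ((X.filter fun y => y < x').image fun y => s(y, c))) :
        Set (Sym2 (Fin n))) :=
      Finset.mem_coe.2 (Finset.mem_insert_of_mem
        (Finset.mem_image.2 ⟨x, Finset.mem_filter.2 ⟨hx, hlt⟩, rfl⟩))
    have hEq : s(x, c) = s(x', c) := Set.mem_singleton_iff.1 ((h' _ hmem).1 hxc)
    rcases Sym2.eq_iff.1 hEq with ⟨h1, _⟩ | ⟨h1, h2⟩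
    · exact hne h1
    · exact hne (h1.trans h2)
  · have hmem : s(x', c) ∈ (↑(insert s(x, c) ((X.filter fun y => y < x).image fun y => s(y, c))) :
        Set (Sym2 (Fin n))) :=
      Finset.mem_coe.2 (Finset.mem_insert_of_mem
        (Finset.mem_image.2 ⟨x', Finset.mem_filter.2 ⟨hx', hgt⟩, rfl⟩))
    have hEq : s(x', c) = s(x, c) := Set.mem_singleton_iff.1 ((h _ hmem).1 hx'c)
    rcases Sym2.eq_iff.1 hEq with ⟨h1, _⟩ | ⟨h1, h2⟩
    · exact hne h1.symm
    · exact hne (h1.trans h2).symm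

/-- **Ordered-anchor theorem for a glued block, from GLUED comparisons (pre-FKG form).**  Setting of
`orderedAnchor_of_pieces`.  If for every relay `c ∈ A ∖ {a, b}` and every unit `x ∈ X` with
`w s(x,c) ≠ 0`, `μ_{c,x}(a ↔ b) ≤ μ_{c,x}(o ↔ b)`, where `μ_{c,x}` is `prodBernoulli` of `w` with
`T_c = {s(x',c') : x' ∈ X, rk c' < rk c}` pinned closed and then `s(x,c)` pinned OPEN and `s(x',c)`,
`x' < x`, pinned closed (so `c` is glued to the block: the anchor is compared with block-plus-`c` in
`Γ'_c`), then `μ(o ↔ A, o ↮ b) ≤ μ(o ↔ A, a ↮ b)`.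
[cite: KozmaNitzan2024, §3.2 Theorems 4–5 (p. 13) and Question 9 (p. 36)] -/
theorem orderedAnchor_glued (w : Sym2 (Fin n) → unitInterval) (X A : Finset (Fin n)) (o a b : Fin n)
    (rk : Fin n → ℕ) (hrk : Set.InjOn rk ↑A)
    (hoX : o ∉ X) (hoA : o ∉ A) (hXA : Disjoint X A) (hb : b ∈ A) (ha : a ∈ A)
    (hstar : ∀ x ∈ X, w s(o, x) = 1)
    (hstar0 : ∀ y : Fin n, y ≠ o → y ∉ X → w s(o, y) = 0)
    (hunit : ∀ x ∈ X, ∀ z : Fin n, z ≠ o → z ∉ A → w s(x, z) = 0)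
    (hEX : ∀ c ∈ A, c ≠ a → c ≠ b → ∀ x ∈ X, w s(x, c) ≠ 0 →
      (prodBernoulli (pinW (pinW w
          (↑((X ×ˢ A.filter fun d => rk d < rk c).image fun p => s(p.1, p.2)) : Set (Sym2 (Fin n))) ∅)
          (↑(insert s(x, c) ((X.filter fun x' => x' < x).image fun x' => s(x', c))) : Set (Sym2 (Fin n)))
          {s(x, c)})).real (openConn a b) ≤
      (prodBernoulli (pinW (pinW w
          (↑((X ×ˢ A.filter fun d => rk d < rk c).image fun p => s(p.1, p.2)) : Set (Sym2 (Fin n))) ∅)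
          (↑(insert s(x, c) ((X.filter fun x' => x' < x).image fun x' => s(x', c))) : Set (Sym2 (Fin n)))
          {s(x, c)})).real (openConn o b)) :
    (prodBernoulli w).real ((⋃ c ∈ A, openConn o c) ∩ (openConn o b)ᶜ) ≤
      (prodBernoulli w).real ((⋃ c ∈ A, openConn o c) ∩ (openConn a b)ᶜ) := by
  refine orderedAnchor_of_pieces w X A o a b rk hrk hoX hoA hXA hb ha hstar hstar0 hunit ?_
  intro c hc hca hcb
  set T : Finset (Sym2 (Fin n)) := (X ×ˢ A.filter fun d => rk d < rk c).image fun p => s(p.1, p.2) with hT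
  set ν := prodBernoulli (pinW w (↑T : Set (Sym2 (Fin n))) ∅) with hν
  set F : Fin n → Finset (Sym2 (Fin n)) := fun x =>
    insert s(x, c) ((X.filter fun x' => x' < x).image fun x' => s(x', c)) with hF
  have hmeas : ∀ E : Set (BondConfig (Fin n)), MeasurableSet E := fun _ => MeasurableSet.of_discrete
  have hcover : {ω : BondConfig (Fin n) | ∃ x ∈ X, s(x, c) ∈ ω} =
      ⋃ x ∈ X, localCylinder (↑(F x) : Set (Sym2 (Fin n))) {s(x, c)} := orderedAnchor_units_cover X c
  have hsum : ∀ E : Set (BondConfig (Fin n)), ν.real (E ∩ {ω : BondConfig (Fin n) | ∃ x ∈ X, s(x, c) ∈ ω}) =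
      ∑ x ∈ X, ν.real (localCylinder (↑(F x) : Set (Sym2 (Fin n))) {s(x, c)}) *
        (prodBernoulli (pinW (pinW w (↑T : Set (Sym2 (Fin n))) ∅) (↑(F x) : Set (Sym2 (Fin n)))
          {s(x, c)})).real E := by
    intro E
    have hE : E ∩ {ω : BondConfig (Fin n) | ∃ x ∈ X, s(x, c) ∈ ω} =
        ⋃ x ∈ X, (E ∩ localCylinder (↑(F x) : Set (Sym2 (Fin n))) {s(x, c)}) := by
      rw [hcover]; ext ω; simp only [Set.mem_inter_iff, Set.mem_iUnion]; tauto
    rw [hE, measureReal_biUnion_finset (fun x hx x' hx' hne =>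
      (orderedAnchor_units_disjoint X c (Finset.mem_coe.1 hx) (Finset.mem_coe.1 hx') hne).mono
        Set.inter_subset_right Set.inter_subset_right) (fun x _ => hmeas _)]
    refine Finset.sum_congr rfl fun x _ => ?_
    rw [hν, prodBernoulli_real_inter_localCylinder _ (F x) {s(x, c)} (hmeas E)]
  rw [hsum, hsum]
  refine Finset.sum_le_sum fun x hx => ?_
  by_cases hw0 : w s(x, c) = 0
  · -- a weight-zero attachment: the cylinder is null
    have h0 : ν.real (localCylinder (↑(F x) : Set (Sym2 (Fin n))) {s(x, c)}) = 0 := by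
      have hsub : localCylinder (↑(F x) : Set (Sym2 (Fin n))) {s(x, c)} ⊆
          {ω : BondConfig (Fin n) | s(x, c) ∈ ω} := fun ω hω =>
        (hω _ (Finset.mem_coe.2 (Finset.mem_insert_self _ _))).2 (Set.mem_singleton _)
      refine le_antisymm ((measureReal_mono hsub (measure_ne_top _ _)).trans (le_of_eq ?_))
        measureReal_nonneg
      rw [hν, prodBernoulli_real_setOf_mem]
      by_cases hTm : s(x, c) ∈ (↑T : Set (Sym2 (Fin n)))
      · rw [pinW_apply_of_mem_of_not_mem w hTm (Set.notMem_empty _)]; rfl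
      · rw [pinW_apply_of_not_mem w _ hTm, hw0]; rfl
    rw [h0, zero_mul, zero_mul]
  · exact mul_le_mul_of_nonneg_left (hEX c hc hca hcb x hx hw0) measureReal_nonneg

end

end Summit.CriticalPhenomena.PercolationContinuityZ3.Theorems
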